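import Mathlib.Analysis.SpecialFunctions.Pow.Real
import Mathlib.Analysis.SpecialFunctions.Log.Basic
import Literature.Probability.LatticeModels.PointwiseScalingLimitSelfSimilar
import Literature.Probability.LatticeModels.CriticalScalingDimension
import HarnessLib

/-!
# Scale covariance is automatic for non-degenerate pointwise scaling limits of the critical Ising
# correlators

Topic `Probability/LatticeModels`; family `crit-ising`. THEOREM-ONLY leaf file (no definitions, no
named facts). For the critical nearest-neighbour Ising correlators `criticalCorr d` on `ℤ^d`, `d ≥ 1`,
and a pointwise scaling limit `S` (`HasPointwiseScalingLimit (criticalCorr d) ρ S`, full filter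
`δ → 0⁺`, `ρ > 0` on `(0,1]`) with non-degenerate two-point function:

* `HasPointwiseScalingLimit.exists_rpow_scale` — **there is `Δ ≥ 0` with
  `S n (c·x) = c^{-nΔ} S n x` for every `c > 0`, every `n` and every NON-COINCIDENT `x`.**
  So clause "scale covariant with some `Δ`" of the conformal-limit problem on `ℤ³`
  (`IsScaleCovariant Δ S` restricted to non-coincident configurations — on the coincident locus a
  pointwise limit is unconstrained) is a CONSEQUENCE of existence + non-degeneracy, not an extra
  hypothesis; only the VALUE of `Δ` (conjecturally `Δ_σ = 0.518…`; rigorously `Δ ∈ [1/2,1]` on `ℤ³`,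
  `scalingDimension_mem_Icc`) carries information.
* `HasPointwiseScalingLimit.exists_rpow_scale_mem_Icc` — on `ℤ³` that `Δ` lies in `[1/2, 1]`
  (through the normalised family `S·𝟙_{NC}` and the tree theorem `scalingDimension_mem_Icc_holds`).
* `HasPointwiseScalingLimit.exists_rpow_scale_and_ratio` — the renormalisation is regularly varying:
  `ρ(cδ)/ρ(δ) → c^{-Δ}` (Lamperti-type consequence, derived not assumed).

Mechanism (no regular variation of `ρ` is assumed): by self-similarity
(`HasPointwiseScalingLimit.comp_smul`) `x ↦ S(cx)` is a limit of the same lattice family, so by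
uniqueness up to scale (`exists_scale_of_isNondegenerateTwoPoint`) `S n (c·x) = F(c)ⁿ S n x` with
`F(c) = (S₂(c x₀)/S₂(x₀))^{1/2}`; `F` is multiplicative, and `F(c) ≥ 1` for `c ≤ 1/(d+1)` by the
Messager–Miracle-Solé comparison in the limit (`two_le_two_of_mul_norm_lt`); an additive function
(`t ↦ log F(e^{-t})`) that is monotone is linear (`eq_mul_of_monotone_of_map_add_real`), whence
`F(c) = c^{-Δ}`.

## References

* A. Messager, S. Miracle-Solé, J. Stat. Phys. 17 (1977) 245–262 [MessagerMiracleSoleJSP1977].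
* P. Di Francesco, P. Mathieu, D. Sénéchal, *Conformal Field Theory* (1997), §4.3.1 (scale
  covariance of quasi-primary correlators) [FrancescoMathieuSenechal1997].
-/

noncomputable section

open Filter Topology Set

namespace Literature.Probability.LatticeModels

variable {d : ℕ}

/-! ### A monotone additive function on `ℝ` is linear -/

/-- **Monotone additive functions are linear**: if `g : ℝ → ℝ` is monotone and `g(s+t) = g s + g t`
then `g t = t · g 1` (floor squeeze along `k/n ≤ t < (k+1)/n`; cf. the `ℝ≥0` version
`eq_mul_of_monotone_of_map_add` of `RestrictionExponent`). [folklore] -/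
theorem eq_mul_of_monotone_of_map_add_real {g : ℝ → ℝ} (hmono : Monotone g)
    (hadd : ∀ s t, g (s + t) = g s + g t) (t : ℝ) : g t = t * g 1 := by
  have hg0 : g 0 = 0 := by have := hadd 0 0; simpa using this
  have hnat : ∀ (n : ℕ) (u : ℝ), g (n * u) = n * g u := by
    intro n u
    induction n with
    | zero => simp [hg0]
    | succ n ih =>
      have : ((n + 1 : ℕ) : ℝ) * u = n * u + u := by push_cast; ring
      rw [this, hadd, ih]; push_cast; ring
  have hc0 : 0 ≤ g 1 := by rw [← hg0]; exact hmono zero_le_one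
  have hrat : ∀ m n : ℕ, 0 < n → g ((m : ℝ) / n) = (m / n : ℝ) * g 1 := by
    intro m n hn
    have hn' : (n : ℝ) ≠ 0 := by exact_mod_cast hn.ne'
    have h1 : g 1 = n * g ((n : ℝ)⁻¹) := by rw [← hnat n, mul_inv_cancel₀ hn']
    have h2 : g ((m : ℝ) / n) = m * g ((n : ℝ)⁻¹) := by rw [div_eq_mul_inv, hnat]
    rw [h2, h1]
    field_simp
  -- nonnegative arguments by squeezing, negative ones by oddness
  have hneg : ∀ u, g (-u) = -g u := fun u => by
    have := hadd u (-u); rw [add_neg_cancel, hg0] at this; linarith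
  wlog ht : 0 ≤ t generalizing t
  · have h := this (-t) (by linarith)
    rw [hneg] at h
    linarith
  refine le_antisymm ?_ ?_ <;> refine le_of_forall_pos_lt_add fun ε hε => ?_ <;>
    obtain ⟨n, hn⟩ := exists_nat_gt (g 1 / ε) <;>
    have hn0 : 0 < n := by
      rcases Nat.eq_zero_or_pos n with rfl | h
      · exfalso; simp at hn; exact absurd hn (not_lt.2 (div_nonneg hc0 hε.le))
      · exact h
  · set m := ⌊t * n⌋₊ with hm
    have hnR : (0 : ℝ) < n := by exact_mod_cast hn0
    have hle : t ≤ ((m + 1 : ℕ) : ℝ) / n := by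
      rw [le_div_iff₀ hnR]
      exact_mod_cast (Nat.lt_floor_add_one (t * n)).le
    have hfl : (m : ℝ) ≤ t * n := Nat.floor_le (by positivity)
    calc g t ≤ g (((m + 1 : ℕ) : ℝ) / n) := hmono hle
      _ = ((m + 1 : ℕ) / n : ℝ) * g 1 := hrat _ _ hn0
      _ ≤ t * g 1 + g 1 / n := by
          push_cast
          rw [add_div, add_mul]
          gcongr ?_ + ?_
          · exact mul_le_mul_of_nonneg_right ((div_le_iff₀ hnR).2 hfl) hc0
          · rw [div_mul_eq_mul_div, one_mul]
      _ < t * g 1 + ε := by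
          gcongr
          rw [div_lt_iff₀ hnR]
          rw [div_lt_iff₀ hε] at hn
          linarith
  · set m := ⌊t * n⌋₊ with hm
    have hnR : (0 : ℝ) < n := by exact_mod_cast hn0
    have hle : ((m : ℕ) : ℝ) / n ≤ t := by
      rw [div_le_iff₀ hnR]
      exact Nat.floor_le (by positivity)
    have hfl : t * n < (m : ℝ) + 1 := Nat.lt_floor_add_one (t * n)
    calc t * g 1 ≤ ((m : ℕ) / n : ℝ) * g 1 + g 1 / n := by
          have : t ≤ (m : ℝ) / n + 1 / n := by
            rw [← add_div, le_div_iff₀ hnR]; exact hfl.le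
          calc t * g 1 ≤ ((m : ℝ) / n + 1 / n) * g 1 := mul_le_mul_of_nonneg_right this hc0
            _ = ((m : ℕ) / n : ℝ) * g 1 + g 1 / n := by ring
      _ = g ((m : ℝ) / n) + g 1 / n := by rw [hrat _ _ hn0]
      _ ≤ g t + g 1 / n := by gcongr; exact hmono hle
      _ < g t + ε := by
          gcongr
          rw [div_lt_iff₀ hnR]
          rw [div_lt_iff₀ hε] at hn
          linarith

/-! ### The scale function of a non-degenerate pointwise limit -/

section ScaleFunction

variable {ρ : ℝ → ℝ} {S : CorrFamily d}

/-- The reference pair `(0, e₀)` (`d ≥ 1`). [folklore] -/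
theorem refPair_mem_nonCoincident (hd : 1 ≤ d) :
    (![0, EuclideanSpace.single (⟨0, hd⟩ : Fin d) (1:ℝ)] : Fin 2 → EuclideanSpace ℝ (Fin d))
      ∈ NonCoincident d 2 := by
  refine pair_mem_nonCoincident fun h => ?_
  have := congrArg (fun v : EuclideanSpace ℝ (Fin d) => v ⟨0, hd⟩) h
  simp at this

/-- **The scale identity with an explicit scale function.** For a non-degenerate pointwise limit of
`criticalCorr d` (`d ≥ 1`, `ρ > 0` on `(0,1]`) and the reference pair `x₀ = (0,e₀)`, the function
`F(c) := (S₂(c·x₀)/S₂(x₀))^{1/2}` satisfies `S n (c·x) = F(c)ⁿ S n x` for all `c > 0`, all `n` and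
all non-coincident `x`; `F > 0` and `F` is multiplicative. [folklore] -/
theorem HasPointwiseScalingLimit.scale_identity (hd : 1 ≤ d)
    (hρ : ∀ δ ∈ Set.Ioc (0:ℝ) 1, 0 < ρ δ) (hlim : HasPointwiseScalingLimit (criticalCorr d) ρ S)
    (hnd : IsNondegenerateTwoPoint S) :
    let x₀ : Fin 2 → EuclideanSpace ℝ (Fin d) := ![0, EuclideanSpace.single (⟨0, hd⟩ : Fin d) (1:ℝ)]
    let F : ℝ → ℝ := fun c => Real.sqrt (S 2 (fun i => c • x₀ i) / S 2 x₀)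
    (∀ c, 0 < c → 0 < F c) ∧
    (∀ c, 0 < c → ∀ n, ∀ x ∈ NonCoincident d n, S n (fun i => c • x i) = F c ^ n * S n x) ∧
    (∀ a b, 0 < a → 0 < b → F (a * b) = F a * F b) := by
  intro x₀ F
  have hx₀ : x₀ ∈ NonCoincident d 2 := refPair_mem_nonCoincident hd
  have ha₀ : 0 < S 2 x₀ := hnd _ hx₀
  have hd0 : 0 < d := hd
  -- positivity of `F`
  have hFpos : ∀ c, 0 < c → 0 < F c := fun c hc =>
    Real.sqrt_pos.2 (div_pos (hnd _ (smul_mem_nonCoincident hc.ne' hx₀)) ha₀)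
  have hFsq : ∀ c, 0 < c → F c ^ 2 = S 2 (fun i => c • x₀ i) / S 2 x₀ := fun c hc =>
    Real.sq_sqrt (div_pos (hnd _ (smul_mem_nonCoincident hc.ne' hx₀)) ha₀).le
  -- the identity for `c ∈ (0,1]` from uniqueness up to scale
  have hsmall : ∀ c, 0 < c → c ≤ 1 → ∀ n, ∀ x ∈ NonCoincident d n,
      S n (fun i => c • x i) = F c ^ n * S n x := by
    intro c hc hc1
    have hlimc := hlim.comp_smul hc
    have hρc : ∀ δ ∈ Set.Ioc (0:ℝ) 1, 0 < ρ (c * δ) := fun δ hδ =>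
      hρ _ ⟨mul_pos hc hδ.1, mul_le_one₀ hc1 hδ.1.le hδ.2⟩
    have hndc : IsNondegenerateTwoPoint (fun n x => S n (fun i => c • x i)) := fun x hx =>
      hnd _ (smul_mem_nonCoincident hc.ne' hx)
    obtain ⟨κ, hκ, hscale⟩ :=
      hlim.exists_scale_of_isNondegenerateTwoPoint hd0 hρ hρc hlimc hnd hndc
    -- `κ = F c`
    have hκF : κ = F c := by
      have h2 : S 2 (fun i => c • x₀ i) = κ ^ 2 * S 2 x₀ := hscale 2 x₀ hx₀
      have : κ ^ 2 = F c ^ 2 := by rw [hFsq c hc, h2, mul_div_assoc, div_self ha₀.ne', mul_one]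
      have := congrArg Real.sqrt this
      rwa [Real.sqrt_sq hκ.le, Real.sqrt_sq (hFpos c hc).le] at this
    intro n x hx
    rw [← hκF]
    exact hscale n x hx
  -- the identity for all `c > 0`
  have hall : ∀ c, 0 < c → ∀ n, ∀ x ∈ NonCoincident d n,
      S n (fun i => c • x i) = F c ^ n * S n x := by
    intro c hc n x hx
    rcases le_or_gt c 1 with hc1 | hc1
    · exact hsmall c hc hc1 n x hx
    · -- use `c⁻¹ ≤ 1` at the configuration `c • x`, and `F c⁻¹ * F c = 1`
      have hci : 0 < c⁻¹ := inv_pos.2 hc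
      have hci1 : c⁻¹ ≤ 1 := inv_le_one_of_one_le₀ hc1.le
      have hcx : (fun i => c • x i) ∈ NonCoincident d n := smul_mem_nonCoincident hc.ne' hx
      have key : S n x = F c⁻¹ ^ n * S n (fun i => c • x i) := by
        have h := hsmall c⁻¹ hci hci1 n _ hcx
        simp only [smul_smul, inv_mul_cancel₀ hc.ne', one_smul] at h
        exact h
      have hprod : F c⁻¹ * F c = 1 := by
        have h := hsmall c⁻¹ hci hci1 2 _ (smul_mem_nonCoincident hc.ne' hx₀)
        simp only [smul_smul, inv_mul_cancel₀ hc.ne', one_smul] at h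
        -- `h : S 2 x₀ = F c⁻¹ ^ 2 * S 2 (c • x₀)` and `(F c)^2 = S 2 (c•x₀)/S 2 x₀`
        have h2 : S 2 (fun i => c • x₀ i) = F c ^ 2 * S 2 x₀ := by
          rw [hFsq c hc, div_mul_cancel₀ _ ha₀.ne']
        rw [h2] at h
        have hsq : (F c⁻¹ * F c) ^ 2 = 1 := by
          have : S 2 x₀ * ((F c⁻¹ * F c) ^ 2 - 1) = 0 := by nlinarith [h]
          have := (mul_eq_zero.1 this).resolve_left ha₀.ne'
          linarith
        have hnn : 0 ≤ F c⁻¹ * F c := (mul_pos (hFpos _ hci) (hFpos _ hc)).le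
        nlinarith [hsq, hnn]
      have hFci : F c⁻¹ = (F c)⁻¹ := eq_inv_of_mul_eq_one_left hprod
      rw [key, hFci, inv_pow, ← mul_assoc, mul_inv_cancel₀ (pow_ne_zero n (hFpos c hc).ne'), one_mul]
  refine ⟨hFpos, hall, fun a b ha hb => ?_⟩
  -- multiplicativity from the identity at `n = 2`, `x₀`
  have h1 : S 2 (fun i => (a * b) • x₀ i) = F (a * b) ^ 2 * S 2 x₀ := hall _ (mul_pos ha hb) 2 x₀ hx₀
  have h2 : S 2 (fun i => (a * b) • x₀ i) = F a ^ 2 * (F b ^ 2 * S 2 x₀) := by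
    have hb' := hall b hb 2 x₀ hx₀
    have ha' := hall a ha 2 _ (smul_mem_nonCoincident hb.ne' hx₀)
    simp only [smul_smul] at ha'
    rw [ha', hb']
  have hsq : F (a * b) ^ 2 = (F a * F b) ^ 2 := by
    have : S 2 x₀ * (F (a * b) ^ 2 - (F a * F b) ^ 2) = 0 := by nlinarith [h1, h2]
    have := (mul_eq_zero.1 this).resolve_left ha₀.ne'
    linarith
  have := congrArg Real.sqrt hsq
  rwa [Real.sqrt_sq (hFpos _ (mul_pos ha hb)).le,
    Real.sqrt_sq (mul_pos (hFpos a ha) (hFpos b hb)).le] at this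

end ScaleFunction

/-! ### Scale covariance -/

/-- **Scale covariance is automatic.** For a non-degenerate pointwise scaling limit `S` of the critical
Ising correlators on `ℤ^d` (`d ≥ 1`, `ρ > 0` on `(0,1]`) there is `Δ ≥ 0` such that
`S n (c·x) = c^{-nΔ} · S n x` for all `c > 0`, all `n` and all non-coincident `x` — i.e. `S` is scale
covariant with dimension `Δ` on non-coincident configurations (the content of `IsScaleCovariant Δ` for
the normalised family). [cite: FrancescoMathieuSenechal1997, §4.3.1] -/
theorem HasPointwiseScalingLimit.exists_rpow_scale (hd : 1 ≤ d) {ρ : ℝ → ℝ} {S : CorrFamily d}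
    (hρ : ∀ δ ∈ Set.Ioc (0:ℝ) 1, 0 < ρ δ) (hlim : HasPointwiseScalingLimit (criticalCorr d) ρ S)
    (hnd : IsNondegenerateTwoPoint S) :
    ∃ Δ : ℝ, 0 ≤ Δ ∧ ∀ (n : ℕ) (c : ℝ), 0 < c → ∀ x ∈ NonCoincident d n,
      S n (fun i => c • x i) = c ^ (-(n : ℝ) * Δ) * S n x := by
  obtain ⟨hFpos, hall, hmul⟩ := hlim.scale_identity hd hρ hnd
  set x₀ : Fin 2 → EuclideanSpace ℝ (Fin d) := ![0, EuclideanSpace.single (⟨0, hd⟩ : Fin d) (1:ℝ)]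
    with hx₀def
  set F : ℝ → ℝ := fun c => Real.sqrt (S 2 (fun i => c • x₀ i) / S 2 x₀) with hFdef
  have hx₀ : x₀ ∈ NonCoincident d 2 := refPair_mem_nonCoincident hd
  have ha₀ : 0 < S 2 x₀ := hnd _ hx₀
  have hd0 : (0:ℝ) < d := by exact_mod_cast hd
  -- `F(c) ≥ 1` for `c ≤ 1/(d+1)` (MMS inward comparison in the limit)
  have hFge : ∀ c : ℝ, 0 < c → c * ((d:ℝ) + 1) ≤ 1 → 1 ≤ F c := by
    intro c hc hcd
    have hcx₀ : (fun i => c • x₀ i) ∈ NonCoincident d 2 := smul_mem_nonCoincident hc.ne' hx₀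
    have hfar : (d:ℝ) * ‖WithLp.ofLp (c • x₀ 0) - WithLp.ofLp (c • x₀ 1)‖ <
        ‖WithLp.ofLp (x₀ 0) - WithLp.ofLp (x₀ 1)‖ := by
      rw [norm_ofLp_smul_sub hc.le]
      have hr : 0 < ‖WithLp.ofLp (x₀ 0) - WithLp.ofLp (x₀ 1)‖ := by
        rw [norm_pos_iff, sub_ne_zero]
        intro h
        have hinj : Function.Injective x₀ := hx₀
        exact absurd (hinj ((WithLp.ofLp_injective 2) h)) (by decide)
      have hdc : (d:ℝ) * c < 1 := by nlinarith
      nlinarith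
    have hle : S 2 x₀ ≤ S 2 (fun i => c • x₀ i) := hlim.two_le_two_of_mul_norm_lt hd hcx₀ hx₀ hfar
    rw [hall c hc 2 x₀ hx₀] at hle
    have h1 : 1 ≤ F c ^ 2 := by
      by_contra h
      have h' := not_le.1 h
      nlinarith [ha₀]
    nlinarith [hFpos c hc, h1]
  -- `g t := log F(e^{-t})` is additive and monotone, hence linear
  set g : ℝ → ℝ := fun t => Real.log (F (Real.exp (-t))) with hgdef
  have hgadd : ∀ s t, g (s + t) = g s + g t := by
    intro s t
    simp only [hgdef, neg_add, Real.exp_add]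
    rw [hmul _ _ (Real.exp_pos _) (Real.exp_pos _),
      Real.log_mul (hFpos _ (Real.exp_pos _)).ne' (hFpos _ (Real.exp_pos _)).ne']
  have hg0 : g 0 = 0 := by have := hgadd 0 0; simpa using this
  have hgnat : ∀ (N : ℕ) (u : ℝ), g (N * u) = N * g u := by
    intro N u
    induction N with
    | zero => simp [hg0]
    | succ n ih =>
      have : ((n + 1 : ℕ) : ℝ) * u = n * u + u := by push_cast; ring
      rw [this, hgadd, ih]; push_cast; ring
  have hgnonneg : ∀ u, 0 ≤ u → 0 ≤ g u := by
    intro u hu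
    rcases hu.eq_or_lt with rfl | hu'
    · rw [hg0]
    · -- choose `N` with `N u ≥ log (d+1)`; then `e^{-Nu} (d+1) ≤ 1`
      obtain ⟨N, hN⟩ := exists_nat_ge (Real.log (d + 1) / u)
      have hNu : Real.log (d + 1) ≤ N * u := by rwa [div_le_iff₀ hu'] at hN
      have hN0 : 0 < (N:ℝ) := by
        have hlogpos : 0 < Real.log (d + 1) := Real.log_pos (by linarith)
        by_contra h
        have h' := not_lt.1 h
        nlinarith
      have hsmall : Real.exp (-(N * u)) * ((d:ℝ) + 1) ≤ 1 := by
        rw [Real.exp_neg, inv_mul_le_iff₀ (Real.exp_pos _), mul_one]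
        calc (d:ℝ) + 1 = Real.exp (Real.log (d + 1)) := (Real.exp_log (by linarith)).symm
          _ ≤ Real.exp (N * u) := Real.exp_le_exp.2 hNu
      have hge : 0 ≤ g (N * u) := Real.log_nonneg (hFge _ (Real.exp_pos _) hsmall)
      rw [hgnat] at hge
      exact le_of_mul_le_mul_left (by simpa using hge) hN0
  have hgmono : Monotone g := by
    intro s t hst
    have : g t = g s + g (t - s) := by rw [← hgadd]; ring_nf
    rw [this]
    linarith [hgnonneg (t - s) (by linarith)]
  set Δ : ℝ := g 1 with hΔ
  have hglin : ∀ t, g t = t * Δ := eq_mul_of_monotone_of_map_add_real hgmono hgadd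
  have hΔ0 : 0 ≤ Δ := by have := hgnonneg 1 zero_le_one; rwa [hglin, one_mul] at this
  -- `F c = c^{-Δ}`
  have hFrpow : ∀ c, 0 < c → F c = c ^ (-Δ) := by
    intro c hc
    have h1 : F c = Real.exp (g (-Real.log c)) := by
      simp only [hgdef, neg_neg, Real.exp_log hc]
      exact (Real.exp_log (hFpos c hc)).symm
    rw [h1, hglin, Real.rpow_def_of_pos hc]
    congr 1
    ring
  refine ⟨Δ, hΔ0, fun n c hc x hx => ?_⟩
  rw [hall c hc n x hx, hFrpow c hc]
  congr 1
  rw [show (-(n:ℝ) * Δ) = (-Δ) * n by ring, Real.rpow_mul hc.le, Real.rpow_natCast]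


/-! ### On `ℤ³`: the automatic scaling dimension lies in `[1/2, 1]` -/

/-- **Every non-degenerate pointwise scaling limit of the critical Ising₃ correlators is scale
covariant on non-coincident configurations with SOME `Δ ∈ [1/2, 1]`.** The dimension produced by
`exists_rpow_scale` is fed, through the normalised family `S·𝟙_{NonCoincident}` (fully
`IsScaleCovariant`, still a pointwise limit with the same `ρ`), into the tree theorem
`scalingDimension_mem_Icc_holds` (two-point bounds `c‖x‖⁻² ≤ ⟨σ₀σ_x⟩_{β_c} ≤ C‖x‖⁻¹`). So in the
conformal-limit problem on `ℤ³` the clause "scale covariant with some `Δ`" carries no information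
beyond existence and non-degeneracy; only Euclidean (rotation) invariance, inversion covariance, the
VALUE of `Δ` and `U₄ ≢ 0` do. [cite: DuminilCopin2019, Thm. 4.8, §4.4] -/
theorem HasPointwiseScalingLimit.exists_rpow_scale_mem_Icc {ρ : ℝ → ℝ} {S : CorrFamily 3}
    (hρ : ∀ δ ∈ Set.Ioc (0:ℝ) 1, 0 < ρ δ) (hlim : HasPointwiseScalingLimit (criticalCorr 3) ρ S)
    (hnd : IsNondegenerateTwoPoint S) :
    ∃ Δ ∈ Set.Icc (1/2 : ℝ) 1, ∀ (n : ℕ) (c : ℝ), 0 < c → ∀ x ∈ NonCoincident 3 n,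
      S n (fun i => c • x i) = c ^ (-(n : ℝ) * Δ) * S n x := by
  classical
  obtain ⟨Δ, -, hcov⟩ := hlim.exists_rpow_scale (by norm_num) hρ hnd
  refine ⟨Δ, ?_, hcov⟩
  -- the normalised family
  set S' : CorrFamily 3 := fun n z => if Function.Injective z then S n z else 0 with hS'
  have S'_inj : ∀ {n : ℕ} {z : Fin n → EuclideanSpace ℝ (Fin 3)}, Function.Injective z →
      S' n z = S n z := fun hz => by simp only [hS', if_pos hz]
  have S'_ninj : ∀ {n : ℕ} {z : Fin n → EuclideanSpace ℝ (Fin 3)}, ¬ Function.Injective z →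
      S' n z = 0 := fun hz => by simp only [hS', if_neg hz]
  have hlim' : HasPointwiseScalingLimit (criticalCorr 3) ρ S' :=
    fun n => (hlim n).congr_right fun z hz => (S'_inj hz).symm
  have hnd' : IsNondegenerateTwoPoint S' := fun z hz => by rw [S'_inj hz]; exact hnd z hz
  have hsc' : IsScaleCovariant Δ S' := by
    intro n c hc z
    by_cases hz : Function.Injective z
    · have hz' : Function.Injective (fun i => c • z i) := smul_mem_nonCoincident hc.ne' hz
      rw [S'_inj hz', S'_inj hz]
      exact hcov n c hc z hz
    · have hz' : ¬ Function.Injective (fun i => c • z i) := fun h =>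
        hz ((smul_right_injective (EuclideanSpace ℝ (Fin 3)) hc.ne').of_comp_iff z |>.1 h)
      rw [S'_ninj hz', S'_ninj hz, mul_zero]
  exact scalingDimension_mem_Icc_holds ρ Δ S' hlim' hsc' hnd' hρ

/-! ### The renormalisation is regularly varying -/

/-- **The renormalisation of a non-degenerate pointwise limit is regularly varying of index `-Δ`**
(`d ≥ 1`, `ρ > 0` on `(0,1]`): with the automatic dimension `Δ` of `exists_rpow_scale`,
`ρ(cδ)/ρ(δ) → c^{-Δ}` as `δ → 0⁺`, for every `c > 0` (Lamperti-type statement; no regular variation is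
ASSUMED — it is derived from the existence of the full-filter limit: `ρ(cδ)²⟨σ_{[x₀/δ]}σ_{[e₀/δ]}⟩` is the
rescaled correlator of the contracted limit `x ↦ S(cx)`, `comp_smul`). [folklore] -/
theorem HasPointwiseScalingLimit.exists_rpow_scale_and_ratio (hd : 1 ≤ d) {ρ : ℝ → ℝ} {S : CorrFamily d}
    (hρ : ∀ δ ∈ Set.Ioc (0:ℝ) 1, 0 < ρ δ) (hlim : HasPointwiseScalingLimit (criticalCorr d) ρ S)
    (hnd : IsNondegenerateTwoPoint S) :
    ∃ Δ : ℝ, 0 ≤ Δ ∧ (∀ (n : ℕ) (c : ℝ), 0 < c → ∀ x ∈ NonCoincident d n,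
      S n (fun i => c • x i) = c ^ (-(n : ℝ) * Δ) * S n x) ∧
      ∀ c : ℝ, 0 < c → Tendsto (fun δ => ρ (c * δ) / ρ δ) (𝓝[>] 0) (𝓝 (c ^ (-Δ))) := by
  obtain ⟨Δ, hΔ0, hcov⟩ := hlim.exists_rpow_scale hd hρ hnd
  refine ⟨Δ, hΔ0, hcov, fun c hc => ?_⟩
  have hx₀ := refPair_mem_nonCoincident hd
  set x₀ : Fin 2 → EuclideanSpace ℝ (Fin d) := ![0, EuclideanSpace.single (⟨0, hd⟩ : Fin d) (1:ℝ)]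
    with hx₀def
  have ha₀ : 0 < S 2 x₀ := hnd _ hx₀
  -- the two rescaled pair correlators at `x₀`
  have h1 : Tendsto (fun δ => ρ δ ^ 2 * criticalCorr d 2 (fun i => latticeApprox δ (x₀ i))) (𝓝[>] 0)
      (𝓝 (S 2 x₀)) := (hlim 2).tendsto_at hx₀
  have h2 : Tendsto (fun δ => ρ (c * δ) ^ 2 * criticalCorr d 2 (fun i => latticeApprox δ (x₀ i)))
      (𝓝[>] 0) (𝓝 (S 2 (fun i => c • x₀ i))) := by
    have h := ((hlim.comp_smul hc) 2).tendsto_at hx₀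
    refine h.congr fun δ => ?_
    rw [rescaledCorrelator_apply]
  have hS : S 2 (fun i => c • x₀ i) = c ^ (-(2:ℝ) * Δ) * S 2 x₀ := by exact_mod_cast hcov 2 c hc x₀ hx₀
  -- eventually the first one is positive, so the ratio of the two converges
  have hIoc : Set.Ioc (0:ℝ) 1 ∈ 𝓝[>] (0:ℝ) := Ioc_mem_nhdsGT one_pos
  have hev : ∀ᶠ δ in 𝓝[>] (0:ℝ), δ ∈ Set.Ioc (0:ℝ) 1 ∧ 0 < ρ δ ^ 2 * criticalCorr d 2
      (fun i => latticeApprox δ (x₀ i)) :=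
    (Filter.eventually_of_mem hIoc fun δ hδ => hδ).and (h1.eventually_const_lt ha₀)
  have hratio2 : Tendsto (fun δ => (ρ (c * δ) / ρ δ) ^ 2) (𝓝[>] 0) (𝓝 (c ^ (-(2:ℝ) * Δ))) := by
    have hq := h2.div h1 ha₀.ne'
    rw [hS, mul_div_assoc, div_self ha₀.ne', mul_one] at hq
    refine hq.congr' ?_
    filter_upwards [hev] with δ hδ
    have hg : criticalCorr d 2 (fun i => latticeApprox δ (x₀ i)) ≠ 0 := by
      intro h0; rw [h0, mul_zero] at hδ; exact lt_irrefl _ hδ.2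
    simp only [Pi.div_apply]
    rw [div_pow, mul_div_mul_right _ _ hg]
  -- take square roots
  have hcΔ : 0 < c ^ (-Δ) := Real.rpow_pos_of_pos hc _
  have hsq : c ^ (-(2:ℝ) * Δ) = (c ^ (-Δ)) ^ 2 := by
    rw [show (-(2:ℝ) * Δ) = (-Δ) * 2 by ring, Real.rpow_mul hc.le, Real.rpow_two]
  rw [hsq] at hratio2
  have hsqrt := hratio2.sqrt
  rw [Real.sqrt_sq hcΔ.le] at hsqrt
  refine hsqrt.congr' ?_
  -- eventually `c δ ∈ (0,1]` too, so the ratio is positive and `√(r²) = r`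
  have hIocc : ∀ᶠ δ in 𝓝[>] (0:ℝ), c * δ ∈ Set.Ioc (0:ℝ) 1 := by
    have hm : Set.Ioo (0:ℝ) (1 / c) ∈ 𝓝[>] (0:ℝ) := Ioo_mem_nhdsGT (by positivity)
    filter_upwards [hm] with δ hδ
    refine ⟨mul_pos hc hδ.1, ?_⟩
    have := hδ.2
    rw [lt_div_iff₀ hc] at this
    linarith
  filter_upwards [hev, hIocc] with δ hδ hcδ
  exact Real.sqrt_sq (div_pos (hρ _ hcδ) (hρ _ hδ.1)).le

end Literature.Probability.LatticeModels


end
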